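import Summits.QuantumFields.YangMills.Theorems.UnitScaleTiltProp7CovariantCurlOfGrad
import Literature.MathematicalPhysics.QuantumFieldTheory.Balaban1983to89.B9Thm310CommutatorDataOfPlaquettes
import HarnessLib

/-!
# Route `UnitScaleTilt`, crux K1 «MinimiserStabilityRegPr» (stmt-QuantumFields-19200), route-R E′ path (α′), LEMMA-H-curved, file F-H3 (covariant transport rows) —
# FRAME-AGNOSTIC KERNEL: the covariant derivative and the covariant Laplacian of a FRAME-TRANSPORTED CONSTANT `z ↦ R(P z) m`, and the scalar-weight Leibniz rows

Cell `ym3-torus`, extra width seat `ym-routeR-w4` (g9); companion of this seat's located note `LOCATE-FH3-SECOND-ORDER-ROW-routeRw4g9.md` (19200 evidence, 2026-08-28).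
WHERE THIS SITS.  LEMMA-H-curved (★routeR-w1 g5, memo #57) bounds the biharmonic energy `ℓ·Σ_x‖Δ_Wψ‖²` of the centre-biharmonic field by the energy of ONE explicit extension
`Φ = Σ_{y′} w_{y′}·R(P_{y′}(·)) m(y′)` of the centre data (F-H1 ✓ `Prop7CentreBiharmonicDirichlet.lap_energy_le_of_extension_T3`): scalar C¹ weights `w_{y′}` (F-H2) times
constants transported by frames `P_{y′} : S → 𝔸ˣ` (F-H3).  This file is the frame-agnostic algebra every choice of frame (comb ∕ axial, local Landau) goes through; THEOREMS ONLY
(0 `def`, 0 `sorry`), written on the abstract carrier of `B9Eq39Adjoint` ∕ ✓`Prop7CovariantCurlOfGrad` (sites `S`, directions `ι`, shifts `T : ι → Equiv.Perm S`, background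
`U : ι → S → 𝔸ˣ`, ring ∕ normed ring `𝔸`; letters `R`, `covD`, `covDstar`, `divB`), so that the door's `torusT ∕ unitsField (toUField W) ∕ Matrix (Fin 2) (Fin 2) ℂ` instance is `exact`.
`--supports stmt-QuantumFields-19200`, count-neutral.  YM₃ on T³ is a ladder rung (R3), not the Clay problem; nothing here claims LEMMA-H-curved, a stub, the crux or the gap.

WHAT IS PROVED (ns `…Theorems.Prop7ConjFrameTransport`; the FRAME HOLONOMY of the bond `(x, μ)` is the inline letter `h_μ(x) := (P x)⁻¹·U_μ(x)·P(x + e_μ)`).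
* §1 (any ring) ★ `covD_conjFrame` — `D_U(R(P)m)(x, μ) = R(P x)(R(h_μ(x)) m − m)`: the covariant derivative of a frame-transported constant is the frame-transported CONJUGATION DEFECT of
  the frame holonomy; `covDstar_conjFrame` (the adjoint derivative: the INVERSE holonomy of the arriving bond); `covDstar_covD_eq_neg_secondDiff` (dictionary: `D*_μD_μ = −Δ^U_μ`,
  the covariant second difference of F-H3's design memo); `covD_conjFrame_eq_zero_of` (`h_μ(x) = 1` — a frame-parallel bond, e.g. a comb-tree bond — gives `0`); `R_sub_self_eq_of_commute` (`R(h)m − m = R(h)m̊ − m̊` for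
  `m̊ = m − c`, `c` commuting with `h` — only the traceless part is charged); ★★ `covDstar_covD_conjFrame` — THE SECOND-ORDER SITE ROW, EXACT:
  `D*_μD_μ(R(P)m)(x) = R(P x)[(m − R(h_μ(x − e_μ))⁻¹ m) − (R(h_μ(x)) m − m)]`, and its sum ★★ `divB_covD_conjFrame` (`Δ_U(R(P)m)(x) = R(P x)[Σ_μ …]`, `Δ_U := divB ∘ covD`, the door's
  (116) letters).  To first order in `h = e^{iA}` the bracket is `i[A_μ(x − e_μ) − A_μ(x), m]`: the row is the commutator of `m` with the backward DIVERGENCE of the frame-gauge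
  potential — one plaquette for a Landau frame (`δA = 0`, second order only), NOT one plaquette for a comb frame under the plaquette clause alone (located note, explicit family).
* §2 (algebra over a commutative ring `𝕂`, scalar weights `w : S → 𝕂`) `covD_smul_fun` — `D_U(w·F)(x, μ) = w(x+e_μ)·D_UF(x, μ) + (w(x+e_μ) − w(x))·F(x)`; `covDstar_smul_fun`;
  ★ `covDstar_covD_smul_fun` — `D*_μD_μ(w·F)(x) = w(x)·D*_μD_μF(x) + (∂⁻_μw)(x)·D*_μF(x) − (∂⁺_μw)(x)·D_μF(x) − (∂⁺_μw − ∂⁻_μw)(x)·F(x)`; ★ `divB_covD_smul_fun` (summed: `Δ_U(w·F) =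
  w·Δ_UF + Σ_μ[…]`, the flat second differences of `w` multiplying `F` UNDIFFERENTIATED — the term that carries LEMMA H's main `Σ_c‖δ m‖²` after the partition-of-unity cancellation).
* §3 (normed ring; frames and background bi-contractive = unitary type, ✓`B9Thm310CommutatorDataOfPlaquettes.bicontr_mul∕bicontr_inv` by name) `norm_covD_conjFrame_le` —
  `‖D_U(R(P)m)(x, μ)‖ ≤ 2‖h_μ(x) − 1‖·‖m‖`; `norm_covDstar_conjFrame_le`; `norm_covDstar_covD_conjFrame_le` — `‖D*_μD_μ(R(P)m)(x)‖ ≤ 2(‖h_μ(x − e_μ) − 1‖ + ‖h_μ(x) − 1‖)·‖m‖` (the CRUDE second-order row;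
  the cancellation between the two holonomies is the consumer's analysis).
HONEST SCOPE.  Exact lattice algebra and two triangle inequalities ([folklore]; the letters are [Balaban1985BackgroundPropagators] (3.1)–(3.4)); the comb instance (`P` = comb
transport, `‖h_μ(x) − 1‖ ≤ |x − y′|₁·a` by ✓`B7Prop1Explicit.axial_bond_bound`) and the Landau instance are F-H4's; nothing of LEMMA-H-curved is proved here.

References: T. Bałaban, CMP 99 (1985) 389–434 [Balaban1985BackgroundPropagators] ((3.1)–(3.4) pp.390–391); CMP 98 (1985) 17–51 [Balaban1985Averaging] (pp.24–25, axial gauge);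
CMP 99 (1985) 75–102 [Balaban1985RegularSpaces] ((1.36)–(1.39) p.83, Landau gauge); CMP 102 (1985) 277–309 [Balaban1985Variational] (Prop. 7 p.299).
-/

noncomputable section

namespace Summit.QuantumFields.YangMills.Theorems.Prop7ConjFrameTransport

open Literature.MathematicalPhysics.QuantumFieldTheory.Balaban1983to89
open B9Eq39Adjoint (R R_def R_add R_sub R_one R_inv_R R_smul covD covDstar divB)
open B11Eq135Weitzenbock (norm_R_sub_self_le)
open B9Eq310Hermitian (norm_R_le)
open B9Thm310CommutatorDataOfPlaquettes (bicontr_mul bicontr_inv)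

/-! ## §1 The covariant derivative and Laplacian of a frame-transported constant (any ring) -/

section RingLevel

variable {𝔸 : Type*} [Ring 𝔸] {S : Type*} {ι : Type*} (T : ι → Equiv.Perm S) (U : ι → S → 𝔸ˣ)

/-- ★ **`D_U` OF A FRAME-TRANSPORTED CONSTANT**: for any frame `P : S → 𝔸ˣ` and constant `m`, `D_U(R(P)m)(x, μ) = R(P x)(R(h_μ(x)) m − m)` with the frame holonomy of the bond
`h_μ(x) = (P x)⁻¹·U_μ(x)·P(x+e_μ)`. [cite: Balaban1985BackgroundPropagators, (3.3) p.390] -/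
theorem covD_conjFrame (P : S → 𝔸ˣ) (m : 𝔸) (μ : ι) (x : S) :
    covD T U μ (fun z => R (P z) m) x = R (P x) (R ((P x)⁻¹ * U μ x * P (T μ x)) m - m) := by
  have hg : P x * ((P x)⁻¹ * U μ x * P (T μ x)) = U μ x * P (T μ x) := by group
  show R (U μ x) (R (P (T μ x)) m) - R (P x) m = _
  rw [R_sub, ← B9Eq39Adjoint.R_mul (P x), hg, B9Eq39Adjoint.R_mul]

/-- A frame-parallel bond (`h_μ(x) = 1`, e.g. a bond of the comb tree for the comb frame) carries no covariant derivative. [folklore] -/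
theorem covD_conjFrame_eq_zero_of (P : S → 𝔸ˣ) (m : 𝔸) (μ : ι) (x : S) (h : (P x)⁻¹ * U μ x * P (T μ x) = 1) :
    covD T U μ (fun z => R (P z) m) x = 0 := by
  rw [covD_conjFrame, h, R_one, sub_self, R_def, mul_zero, zero_mul]

/-- **`D*_U` OF A FRAME-TRANSPORTED CONSTANT** (the adjoint ∕ backward derivative): `D*_U(R(P)m)(x, μ) = R(P x)(R(h_μ(x − e_μ))⁻¹ m − m)` — the INVERSE holonomy of the
bond arriving at `x`. [cite: Balaban1985BackgroundPropagators, (3.3) p.390] -/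
theorem covDstar_conjFrame (P : S → 𝔸ˣ) (m : 𝔸) (μ : ι) (x : S) :
    covDstar T U μ (fun z => R (P z) m) x
      = R (P x) (R ((P ((T μ).symm x))⁻¹ * U μ ((T μ).symm x) * P x)⁻¹ m - m) := by
  have hg : (U μ ((T μ).symm x))⁻¹ * P ((T μ).symm x)
      = P x * ((P ((T μ).symm x))⁻¹ * U μ ((T μ).symm x) * P x)⁻¹ := by group
  show R (U μ ((T μ).symm x))⁻¹ (R (P ((T μ).symm x)) m) - R (P x) m = _
  rw [R_sub, ← B9Eq39Adjoint.R_mul (P x), ← hg, B9Eq39Adjoint.R_mul]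

/-- **DICTIONARY — `D*_μD_μ` IS MINUS THE COVARIANT SECOND DIFFERENCE**: `D*_μD_μ f(x) = −(R(U_μ(x)) f(x+e_μ) − 2f(x) + R(U_μ(x−e_μ))⁻¹ f(x−e_μ))`, so that the door's
`Δ_U = divB ∘ covD = −Σ_μ Δ^U_μ` with `Δ^U_μ` the covariant second difference of [Balaban1985BackgroundPropagators] (3.4). [cite: Balaban1985BackgroundPropagators, (3.3)-(3.4) pp.390-391] -/
theorem covDstar_covD_eq_neg_secondDiff (f : S → 𝔸) (μ : ι) (x : S) :
    covDstar T U μ (covD T U μ f) x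
      = -(R (U μ x) (f (T μ x)) - (f x + f x) + R (U μ ((T μ).symm x))⁻¹ (f ((T μ).symm x))) := by
  have hy : T μ ((T μ).symm x) = x := Equiv.apply_symm_apply _ _
  simp only [covDstar, covD, hy, R_sub, R_inv_R]
  abel

/-- Only the part of `m` that does not commute with the holonomy is charged: `R(h)m − m = R(h)(m − c) − (m − c)` whenever `c` commutes with `h` (e.g. `c` = the scalar part
of `m`, `m − c = m̊` its traceless part). [folklore] -/
theorem R_sub_self_eq_of_commute (W : 𝔸ˣ) (m c : 𝔸) (hc : Commute c (W : 𝔸)) :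
    R W m - m = R W (m - c) - (m - c) := by
  have hRc : R W c = c := by
    rw [R_def, ← hc.eq, mul_assoc, Units.mul_inv, mul_one]
  rw [R_sub, hRc]
  abel

/-- ★★ **THE SECOND-ORDER SITE ROW, EXACT**: `D*_μD_μ(R(P)m)(x) = R(P x)[(m − R(h_μ(y))⁻¹ m) − (R(h_μ(x)) m − m)]`, `y = x − e_μ`, `h_μ(y) = (P y)⁻¹U_μ(y)P(x)` — the two
frame holonomies of the bonds through `x` in direction `μ` enter with opposite orientation (to first order: the backward difference of the frame-gauge potential, commutated with `m`).
[cite: Balaban1985BackgroundPropagators, (3.3)-(3.4) pp.390-391] -/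
theorem covDstar_covD_conjFrame (P : S → 𝔸ˣ) (m : 𝔸) (μ : ι) (x : S) :
    covDstar T U μ (covD T U μ (fun z => R (P z) m)) x
      = R (P x) ((m - R ((P ((T μ).symm x))⁻¹ * U μ ((T μ).symm x) * P x)⁻¹ m)
          - (R ((P x)⁻¹ * U μ x * P (T μ x)) m - m)) := by
  have hy : T μ ((T μ).symm x) = x := Equiv.apply_symm_apply _ _
  have hg : (U μ ((T μ).symm x))⁻¹ * P ((T μ).symm x)
      = P x * ((P ((T μ).symm x))⁻¹ * U μ ((T μ).symm x) * P x)⁻¹ := by group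
  show R (U μ ((T μ).symm x))⁻¹ (covD T U μ (fun z => R (P z) m) ((T μ).symm x)) - covD T U μ (fun z => R (P z) m) x = _
  rw [covD_conjFrame, covD_conjFrame, hy, ← B9Eq39Adjoint.R_mul, hg, B9Eq39Adjoint.R_mul,
    R_sub _ (R _ m) m, R_inv_R, ← R_sub]

/-- `R(U)` commutes with finite sums. [folklore] -/
theorem R_finset_sum {β : Type*} (W : 𝔸ˣ) (s : Finset β) (f : β → 𝔸) : R W (∑ i ∈ s, f i) = ∑ i ∈ s, R W (f i) := by
  simp only [R_def, Finset.mul_sum, Finset.sum_mul]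

variable [Fintype ι]

/-- ★★ **THE COVARIANT LAPLACIAN OF A FRAME-TRANSPORTED CONSTANT** (`Δ_U := divB ∘ covD`, the door's (116) letters):
`Δ_U(R(P)m)(x) = R(P x)·Σ_μ[(m − R(h_μ(x − e_μ))⁻¹ m) − (R(h_μ(x)) m − m)]`. [cite: Balaban1985BackgroundPropagators, (3.3)-(3.4) pp.390-391] -/
theorem divB_covD_conjFrame (P : S → 𝔸ˣ) (m : 𝔸) (x : S) :
    divB T U (fun μ => covD T U μ (fun z => R (P z) m)) x
      = R (P x) (∑ μ, ((m - R ((P ((T μ).symm x))⁻¹ * U μ ((T μ).symm x) * P x)⁻¹ m)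
          - (R ((P x)⁻¹ * U μ x * P (T μ x)) m - m))) := by
  simp only [divB, covDstar_covD_conjFrame, R_finset_sum]

end RingLevel

/-! ## §2 Scalar weights: the covariant Leibniz rows -/

section Leibniz

variable {𝕂 : Type*} [CommRing 𝕂] {𝔸 : Type*} [Ring 𝔸] [Algebra 𝕂 𝔸] {S : Type*} {ι : Type*}
  (T : ι → Equiv.Perm S) (U : ι → S → 𝔸ˣ)

/-- **LEIBNIZ, FIRST ORDER**: `D_U(w·F)(x, μ) = w(x+e_μ)·(D_UF)(x, μ) + (w(x+e_μ) − w(x))·F(x)` for a scalar weight `w`. [folklore] -/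
theorem covD_smul_fun (w : S → 𝕂) (F : S → 𝔸) (μ : ι) (x : S) :
    covD T U μ (fun z => w z • F z) x = w (T μ x) • covD T U μ F x + (w (T μ x) - w x) • F x := by
  simp only [covD, R_smul, smul_sub, sub_smul]
  abel

/-- **LEIBNIZ FOR THE ADJOINT DERIVATIVE**: `D*_U(w·G)(x, μ) = w(x−e_μ)·(D*_UG)(x, μ) + (w(x−e_μ) − w(x))·G(x)`. [folklore] -/
theorem covDstar_smul_fun (w : S → 𝕂) (G : S → 𝔸) (μ : ι) (x : S) :
    covDstar T U μ (fun z => w z • G z) x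
      = w ((T μ).symm x) • covDstar T U μ G x + (w ((T μ).symm x) - w x) • G x := by
  simp only [covDstar, R_smul, smul_sub, sub_smul]
  abel

/-- ★ **LEIBNIZ, SECOND ORDER (one direction)**: with `y = x − e_μ`,
`D*_μD_μ(w·F)(x) = w(x)·D*_μD_μF(x) + (w(x) − w(y))·D*_μF(x) − (w(x+e_μ) − w(x))·D_μF(x) − ((w(x+e_μ) − w(x)) − (w(x) − w(y)))·F(x)` — the flat second difference of the
weight multiplies `F` undifferentiated. [folklore] -/
theorem covDstar_covD_smul_fun (w : S → 𝕂) (F : S → 𝔸) (μ : ι) (x : S) :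
    covDstar T U μ (covD T U μ (fun z => w z • F z)) x
      = w x • covDstar T U μ (covD T U μ F) x
        + (w x - w ((T μ).symm x)) • covDstar T U μ F x
        - (w (T μ x) - w x) • covD T U μ F x
        - ((w (T μ x) - w x) - (w x - w ((T μ).symm x))) • F x := by
  have hy : T μ ((T μ).symm x) = x := Equiv.apply_symm_apply _ _
  simp only [covDstar, covD, hy, R_smul, R_sub, R_inv_R, smul_sub, sub_smul]
  module

variable [Fintype ι]

/-- ★ **LEIBNIZ, SECOND ORDER, SUMMED** (`Δ_U := divB ∘ covD`): `Δ_U(w·F)(x) = w(x)·Δ_UF(x) + Σ_μ[(∂⁻_μw)·D*_μF − (∂⁺_μw)·D_μF − (∂⁺_μw − ∂⁻_μw)·F](x)`. [folklore] -/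
theorem divB_covD_smul_fun (w : S → 𝕂) (F : S → 𝔸) (x : S) :
    divB T U (fun μ => covD T U μ (fun z => w z • F z)) x
      = w x • divB T U (fun μ => covD T U μ F) x
        + ∑ μ, ((w x - w ((T μ).symm x)) • covDstar T U μ F x
          - (w (T μ x) - w x) • covD T U μ F x
          - ((w (T μ x) - w x) - (w x - w ((T μ).symm x))) • F x) := by
  simp only [divB, covDstar_covD_smul_fun, Finset.smul_sum, ← Finset.sum_add_distrib]
  refine Finset.sum_congr rfl fun μ _ => ?_
  abel

end Leibniz

/-! ## §3 Norms at a unitary-type frame and background -/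

section NormLevel

-- `𝔸 : Type` (universe 0, as the tree's bi-contraction letters `bicontr_mul∕bicontr_inv` and the door's `Matrix (Fin 2) (Fin 2) ℂ`)
variable {𝔸 : Type} [NormedRing 𝔸] {S : Type*} {ι : Type*} (T : ι → Equiv.Perm S) (U : ι → S → 𝔸ˣ)

/-- **FIRST-ORDER ROW**: `‖D_U(R(P)m)(x, μ)‖ ≤ 2·‖h_μ(x) − 1‖·‖m‖` at a frame and background of unitary type (for the comb frame `‖h_μ(x) − 1‖ ≤ |x − y′|₁·a` by the axial-gauge bond
bound, giving memo #57's `2ℓa‖m̊‖` after `R_sub_self_eq_of_commute`). [cite: Balaban1985Averaging, pp.24-25] -/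
theorem norm_covD_conjFrame_le {P : S → 𝔸ˣ} (hP : ∀ z : S, ‖(P z : 𝔸)‖ ≤ 1 ∧ ‖(((P z)⁻¹ : 𝔸ˣ) : 𝔸)‖ ≤ 1)
    (hU : ∀ (κ : ι) (z : S), ‖(U κ z : 𝔸)‖ ≤ 1 ∧ ‖(((U κ z)⁻¹ : 𝔸ˣ) : 𝔸)‖ ≤ 1) (m : 𝔸) (μ : ι) (x : S) :
    ‖covD T U μ (fun z => R (P z) m) x‖ ≤ 2 * ‖(((P x)⁻¹ * U μ x * P (T μ x) : 𝔸ˣ) : 𝔸) - 1‖ * ‖m‖ := by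
  rw [covD_conjFrame]
  have hh := bicontr_mul (bicontr_mul (bicontr_inv (hP x)) (hU μ x)) (hP (T μ x))
  exact (norm_R_le (hP x).1 (hP x).2 _).trans (norm_R_sub_self_le hh.2 m)

/-- The adjoint first-order row: `‖D*_U(R(P)m)(x, μ)‖ ≤ 2·‖h_μ(x − e_μ) − 1‖·‖m‖`. [cite: Balaban1985Averaging, pp.24-25] -/
theorem norm_covDstar_conjFrame_le {P : S → 𝔸ˣ} (hP : ∀ z : S, ‖(P z : 𝔸)‖ ≤ 1 ∧ ‖(((P z)⁻¹ : 𝔸ˣ) : 𝔸)‖ ≤ 1)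
    (hU : ∀ (κ : ι) (z : S), ‖(U κ z : 𝔸)‖ ≤ 1 ∧ ‖(((U κ z)⁻¹ : 𝔸ˣ) : 𝔸)‖ ≤ 1) (m : 𝔸) (μ : ι) (x : S) :
    ‖covDstar T U μ (fun z => R (P z) m) x‖
      ≤ 2 * ‖(((P ((T μ).symm x))⁻¹ * U μ ((T μ).symm x) * P x : 𝔸ˣ) : 𝔸) - 1‖ * ‖m‖ := by
  rw [covDstar_conjFrame]
  set hy : 𝔸ˣ := (P ((T μ).symm x))⁻¹ * U μ ((T μ).symm x) * P x with hhy
  have bhy := bicontr_mul (bicontr_mul (bicontr_inv (hP ((T μ).symm x))) (hU μ ((T μ).symm x))) (hP x)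
  have hinv : ‖((hy⁻¹ : 𝔸ˣ) : 𝔸) - 1‖ ≤ ‖(hy : 𝔸) - 1‖ := by
    have e : ((hy⁻¹ : 𝔸ˣ) : 𝔸) - 1 = ((hy⁻¹ : 𝔸ˣ) : 𝔸) * (1 - (hy : 𝔸)) := by
      rw [mul_sub, mul_one, Units.inv_mul]
    rw [e]
    calc ‖((hy⁻¹ : 𝔸ˣ) : 𝔸) * (1 - (hy : 𝔸))‖ ≤ ‖((hy⁻¹ : 𝔸ˣ) : 𝔸)‖ * ‖1 - (hy : 𝔸)‖ := norm_mul_le _ _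
      _ ≤ 1 * ‖1 - (hy : 𝔸)‖ := mul_le_mul_of_nonneg_right bhy.2 (norm_nonneg _)
      _ = ‖(hy : 𝔸) - 1‖ := by rw [one_mul, norm_sub_rev]
  calc ‖R (P x) (R hy⁻¹ m - m)‖ ≤ ‖R hy⁻¹ m - m‖ := norm_R_le (hP x).1 (hP x).2 _
    _ ≤ 2 * ‖((hy⁻¹ : 𝔸ˣ) : 𝔸) - 1‖ * ‖m‖ := norm_R_sub_self_le (by rw [inv_inv]; exact bhy.1) m
    _ ≤ 2 * ‖(hy : 𝔸) - 1‖ * ‖m‖ := by gcongr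

/-- **SECOND-ORDER ROW, CRUDE**: `‖D*_μD_μ(R(P)m)(x)‖ ≤ 2·(‖h_μ(x − e_μ) − 1‖ + ‖h_μ(x) − 1‖)·‖m‖` (no cancellation between the two holonomies is used; the located
first-order cancellation — the backward divergence of the frame-gauge potential — is the consumer's analysis). [cite: Balaban1985BackgroundPropagators, (3.3)-(3.4) pp.390-391] -/
theorem norm_covDstar_covD_conjFrame_le {P : S → 𝔸ˣ} (hP : ∀ z : S, ‖(P z : 𝔸)‖ ≤ 1 ∧ ‖(((P z)⁻¹ : 𝔸ˣ) : 𝔸)‖ ≤ 1)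
    (hU : ∀ (κ : ι) (z : S), ‖(U κ z : 𝔸)‖ ≤ 1 ∧ ‖(((U κ z)⁻¹ : 𝔸ˣ) : 𝔸)‖ ≤ 1) (m : 𝔸) (μ : ι) (x : S) :
    ‖covDstar T U μ (covD T U μ (fun z => R (P z) m)) x‖
      ≤ 2 * (‖(((P ((T μ).symm x))⁻¹ * U μ ((T μ).symm x) * P x : 𝔸ˣ) : 𝔸) - 1‖
          + ‖(((P x)⁻¹ * U μ x * P (T μ x) : 𝔸ˣ) : 𝔸) - 1‖) * ‖m‖ := by
  rw [covDstar_covD_conjFrame]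
  set hy : 𝔸ˣ := (P ((T μ).symm x))⁻¹ * U μ ((T μ).symm x) * P x with hhy
  set hx : 𝔸ˣ := (P x)⁻¹ * U μ x * P (T μ x) with hhx
  have bhy := bicontr_mul (bicontr_mul (bicontr_inv (hP ((T μ).symm x))) (hU μ ((T μ).symm x))) (hP x)
  have bhx := bicontr_mul (bicontr_mul (bicontr_inv (hP x)) (hU μ x)) (hP (T μ x))
  -- `‖h⁻¹ − 1‖ ≤ ‖h − 1‖` for a bi-contraction (`h⁻¹ − 1 = h⁻¹(1 − h)`)
  have hinv : ‖((hy⁻¹ : 𝔸ˣ) : 𝔸) - 1‖ ≤ ‖(hy : 𝔸) - 1‖ := by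
    have e : ((hy⁻¹ : 𝔸ˣ) : 𝔸) - 1 = ((hy⁻¹ : 𝔸ˣ) : 𝔸) * (1 - (hy : 𝔸)) := by
      rw [mul_sub, mul_one, Units.inv_mul]
    rw [e]
    calc ‖((hy⁻¹ : 𝔸ˣ) : 𝔸) * (1 - (hy : 𝔸))‖ ≤ ‖((hy⁻¹ : 𝔸ˣ) : 𝔸)‖ * ‖1 - (hy : 𝔸)‖ := norm_mul_le _ _
      _ ≤ 1 * ‖1 - (hy : 𝔸)‖ := mul_le_mul_of_nonneg_right bhy.2 (norm_nonneg _)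
      _ = ‖(hy : 𝔸) - 1‖ := by rw [one_mul, norm_sub_rev]
  have h1 : ‖m - R hy⁻¹ m‖ ≤ 2 * ‖(hy : 𝔸) - 1‖ * ‖m‖ := by
    rw [norm_sub_rev]
    refine (norm_R_sub_self_le (by rw [inv_inv]; exact bhy.1) m).trans ?_
    exact mul_le_mul_of_nonneg_right (mul_le_mul_of_nonneg_left hinv (by norm_num)) (norm_nonneg _)
  have h2 : ‖R hx m - m‖ ≤ 2 * ‖(hx : 𝔸) - 1‖ * ‖m‖ := norm_R_sub_self_le bhx.2 m
  calc ‖R (P x) ((m - R hy⁻¹ m) - (R hx m - m))‖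
      ≤ ‖(m - R hy⁻¹ m) - (R hx m - m)‖ := norm_R_le (hP x).1 (hP x).2 _
    _ ≤ ‖m - R hy⁻¹ m‖ + ‖R hx m - m‖ := norm_sub_le _ _
    _ ≤ 2 * (‖(hy : 𝔸) - 1‖ + ‖(hx : 𝔸) - 1‖) * ‖m‖ := by nlinarith [h1, h2]

end NormLevel

/-! ## §4 (APPEND v1.1) The symmetric-pair form of the second-order row: first order = the DIFFERENCE of the two frame holonomies

The bracket of `covDstar_covD_conjFrame` is `−[(R(h₁)m − m) + (R(h₂⁻¹)m − m)]` with `h₁ = h_μ(x)`, `h₂ = h_μ(x − e_μ)`.  Exact ring algebra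
(`R(K)m − m = [K − 1, m]·K⁻¹`, `R(K⁻¹)m − m = −K⁻¹·[K − 1, m]`) gives `(R h₁ m − m) + (R h₂⁻¹ m − m) = [h₁ − h₂, m] + [h₁ − 1, m](h₁⁻¹ − 1) − (h₂⁻¹ − 1)[h₂ − 1, m]`,
hence at a bi-contractive frame∕background `‖D*_μD_μ(R(P)m)(x)‖ ≤ 2(‖h_μ(x) − h_μ(x − e_μ)‖ + ‖h_μ(x) − 1‖² + ‖h_μ(x − e_μ) − 1‖²)·‖m − c‖` for every CENTRAL `c`
(only `m̊ = m − c` is charged): the first-order part of the row is the backward DIFFERENCE of the frame holonomies along their own direction — one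
plaquette for a frame whose gauge potential has bounded DIFFERENCES (a [Balaban1985BackgroundPropagators] (3.35) cube gauge: `h = e^{iηA}`, `|A| < Cξ⁻¹`,
`|∇^ηA| < Cξ⁻²`; a Landau frame), `O(ℓa)` for a comb frame under the plaquette clause alone (this seat's located family).  No logarithm, no exponential
series: the hypotheses are on the holonomies `h` themselves, so every frame instantiates it by a dictionary row. -/

section PairLevel

variable {𝔸 : Type*} [Ring 𝔸]

/-- `R(K)m − m = [K − 1, m]·K⁻¹` — exact. [folklore] -/
theorem R_sub_self_eq_comm_mul (K : 𝔸ˣ) (m : 𝔸) :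
    R K m - m = (((K : 𝔸) - 1) * m - m * ((K : 𝔸) - 1)) * ((K⁻¹ : 𝔸ˣ) : 𝔸) := by
  rw [R_def]
  have hK : (K : 𝔸) * ((K⁻¹ : 𝔸ˣ) : 𝔸) = 1 := Units.mul_inv K
  calc (K : 𝔸) * m * ((K⁻¹ : 𝔸ˣ) : 𝔸) - m = (K : 𝔸) * m * ((K⁻¹ : 𝔸ˣ) : 𝔸) - m * ((K : 𝔸) * ((K⁻¹ : 𝔸ˣ) : 𝔸)) := by
        rw [hK, mul_one]
    _ = _ := by noncomm_ring

/-- `R(K⁻¹)m − m = −K⁻¹·[K − 1, m]` — exact. [folklore] -/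
theorem R_inv_sub_self_eq_neg_mul_comm (K : 𝔸ˣ) (m : 𝔸) :
    R K⁻¹ m - m = -(((K⁻¹ : 𝔸ˣ) : 𝔸) * (((K : 𝔸) - 1) * m - m * ((K : 𝔸) - 1))) := by
  rw [R_def, inv_inv]
  have hK : ((K⁻¹ : 𝔸ˣ) : 𝔸) * (K : 𝔸) = 1 := Units.inv_mul K
  calc ((K⁻¹ : 𝔸ˣ) : 𝔸) * m * (K : 𝔸) - m = ((K⁻¹ : 𝔸ˣ) : 𝔸) * m * (K : 𝔸) - ((K⁻¹ : 𝔸ˣ) : 𝔸) * (K : 𝔸) * m := by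
        rw [hK, one_mul]
    _ = _ := by noncomm_ring

/-- ★ **THE SYMMETRIC PAIR, EXACT**: `(R h₁ m − m) + (R h₂⁻¹ m − m) = [h₁ − h₂, m] + [h₁ − 1, m](h₁⁻¹ − 1) − (h₂⁻¹ − 1)[h₂ − 1, m]` — first order the
DIFFERENCE of the two holonomies, the rest quadratic in `h − 1`. [folklore] -/
theorem symmPair_eq (h₁ h₂ : 𝔸ˣ) (m : 𝔸) :
    (R h₁ m - m) + (R h₂⁻¹ m - m)
      = (((h₁ : 𝔸) - h₂) * m - m * ((h₁ : 𝔸) - h₂))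
        + (((h₁ : 𝔸) - 1) * m - m * ((h₁ : 𝔸) - 1)) * (((h₁⁻¹ : 𝔸ˣ) : 𝔸) - 1)
        - (((h₂⁻¹ : 𝔸ˣ) : 𝔸) - 1) * (((h₂ : 𝔸) - 1) * m - m * ((h₂ : 𝔸) - 1)) := by
  rw [R_sub_self_eq_comm_mul, R_inv_sub_self_eq_neg_mul_comm]
  noncomm_ring

/-- A commutator only sees the non-central part: `Xm − mX = X(m − c) − (m − c)X` for central `c`. [folklore] -/
theorem comm_eq_comm_sub_central (X m c : 𝔸) (hc : ∀ a : 𝔸, Commute c a) :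
    X * m - m * X = X * (m - c) - (m - c) * X := by
  have h := (hc X).eq
  rw [mul_sub, sub_mul, h]
  abel

end PairLevel

section PairNorm

variable {𝔸 : Type} [NormedRing 𝔸] {S : Type*} {ι : Type*} (T : ι → Equiv.Perm S) (U : ι → S → 𝔸ˣ)

omit T U in
/-- ★ **NORM OF THE SYMMETRIC PAIR** at bi-contractive holonomies: `‖(R h₁ m − m) + (R h₂⁻¹ m − m)‖ ≤ 2(‖h₁ − h₂‖ + ‖h₁ − 1‖² + ‖h₂ − 1‖²)·‖m − c‖`
for every central `c`. [folklore] -/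
theorem norm_symmPair_le {h₁ h₂ : 𝔸ˣ} (b₁ : ‖(h₁ : 𝔸)‖ ≤ 1 ∧ ‖((h₁⁻¹ : 𝔸ˣ) : 𝔸)‖ ≤ 1) (b₂ : ‖(h₂ : 𝔸)‖ ≤ 1 ∧ ‖((h₂⁻¹ : 𝔸ˣ) : 𝔸)‖ ≤ 1)
    (m c : 𝔸) (hc : ∀ a : 𝔸, Commute c a) :
    ‖(R h₁ m - m) + (R h₂⁻¹ m - m)‖
      ≤ 2 * (‖(h₁ : 𝔸) - h₂‖ + ‖(h₁ : 𝔸) - 1‖ ^ 2 + ‖(h₂ : 𝔸) - 1‖ ^ 2) * ‖m - c‖ := by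
  rw [symmPair_eq, comm_eq_comm_sub_central _ m c hc, comm_eq_comm_sub_central ((h₁ : 𝔸) - 1) m c hc,
    comm_eq_comm_sub_central ((h₂ : 𝔸) - 1) m c hc]
  set n := m - c with hn
  -- commutator norms
  have hcomm : ∀ X : 𝔸, ‖X * n - n * X‖ ≤ 2 * ‖X‖ * ‖n‖ := fun X =>
    (norm_sub_le _ _).trans (by nlinarith [norm_mul_le X n, norm_mul_le n X, norm_nonneg X, norm_nonneg n])
  -- `‖h⁻¹ − 1‖ ≤ ‖h − 1‖`
  have hinv : ∀ {h : 𝔸ˣ}, ‖((h⁻¹ : 𝔸ˣ) : 𝔸)‖ ≤ 1 → ‖((h⁻¹ : 𝔸ˣ) : 𝔸) - 1‖ ≤ ‖(h : 𝔸) - 1‖ := by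
    intro h hh
    have e : ((h⁻¹ : 𝔸ˣ) : 𝔸) - 1 = ((h⁻¹ : 𝔸ˣ) : 𝔸) * (1 - (h : 𝔸)) := by rw [mul_sub, mul_one, Units.inv_mul]
    rw [e]
    calc ‖((h⁻¹ : 𝔸ˣ) : 𝔸) * (1 - (h : 𝔸))‖ ≤ ‖((h⁻¹ : 𝔸ˣ) : 𝔸)‖ * ‖1 - (h : 𝔸)‖ := norm_mul_le _ _
      _ ≤ 1 * ‖1 - (h : 𝔸)‖ := mul_le_mul_of_nonneg_right hh (norm_nonneg _)
      _ = ‖(h : 𝔸) - 1‖ := by rw [one_mul, norm_sub_rev]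
  have i1 := hinv b₁.2
  have i2 := hinv b₂.2
  have t1 := hcomm ((h₁ : 𝔸) - h₂)
  have t2 : ‖(((h₁ : 𝔸) - 1) * n - n * ((h₁ : 𝔸) - 1)) * (((h₁⁻¹ : 𝔸ˣ) : 𝔸) - 1)‖ ≤ 2 * ‖(h₁ : 𝔸) - 1‖ ^ 2 * ‖n‖ := by
    refine (norm_mul_le _ _).trans ?_
    have := hcomm ((h₁ : 𝔸) - 1)
    have h0 : 0 ≤ ‖(h₁ : 𝔸) - 1‖ := norm_nonneg _
    have hn0 : 0 ≤ ‖n‖ := norm_nonneg _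
    have hi0 : 0 ≤ ‖((h₁⁻¹ : 𝔸ˣ) : 𝔸) - 1‖ := norm_nonneg _
    nlinarith [mul_le_mul this i1 hi0 (by positivity)]
  have t3 : ‖(((h₂⁻¹ : 𝔸ˣ) : 𝔸) - 1) * (((h₂ : 𝔸) - 1) * n - n * ((h₂ : 𝔸) - 1))‖ ≤ 2 * ‖(h₂ : 𝔸) - 1‖ ^ 2 * ‖n‖ := by
    refine (norm_mul_le _ _).trans ?_
    have := hcomm ((h₂ : 𝔸) - 1)
    have h0 : 0 ≤ ‖(h₂ : 𝔸) - 1‖ := norm_nonneg _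
    have hn0 : 0 ≤ ‖n‖ := norm_nonneg _
    have hi0 : 0 ≤ ‖((h₂⁻¹ : 𝔸ˣ) : 𝔸) - 1‖ := norm_nonneg _
    nlinarith [mul_le_mul i2 this (by positivity) h0]
  calc _ ≤ ‖((h₁ : 𝔸) - h₂) * n - n * ((h₁ : 𝔸) - h₂)
            + (((h₁ : 𝔸) - 1) * n - n * ((h₁ : 𝔸) - 1)) * (((h₁⁻¹ : 𝔸ˣ) : 𝔸) - 1)‖
          + ‖(((h₂⁻¹ : 𝔸ˣ) : 𝔸) - 1) * (((h₂ : 𝔸) - 1) * n - n * ((h₂ : 𝔸) - 1))‖ := norm_sub_le _ _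
    _ ≤ ‖((h₁ : 𝔸) - h₂) * n - n * ((h₁ : 𝔸) - h₂)‖
          + ‖(((h₁ : 𝔸) - 1) * n - n * ((h₁ : 𝔸) - 1)) * (((h₁⁻¹ : 𝔸ˣ) : 𝔸) - 1)‖
          + ‖(((h₂⁻¹ : 𝔸ˣ) : 𝔸) - 1) * (((h₂ : 𝔸) - 1) * n - n * ((h₂ : 𝔸) - 1))‖ := by
        gcongr; exact norm_add_le _ _
    _ ≤ 2 * (‖(h₁ : 𝔸) - h₂‖ + ‖(h₁ : 𝔸) - 1‖ ^ 2 + ‖(h₂ : 𝔸) - 1‖ ^ 2) * ‖n‖ := by nlinarith [t1, t2, t3]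

/-- ★★ **THE SECOND-ORDER SITE ROW, SYMMETRIC-PAIR FORM**: at a bi-contractive frame `P` and background `U`, for every central `c`,
`‖D*_μD_μ(R(P)m)(x)‖ ≤ 2·(‖h_μ(x) − h_μ(x − e_μ)‖ + ‖h_μ(x) − 1‖² + ‖h_μ(x − e_μ) − 1‖²)·‖m − c‖` — first order the backward DIFFERENCE of the frame
holonomies (one plaquette for a (3.35) cube gauge or a Landau frame), second order their sizes. [cite: Balaban1985BackgroundPropagators, (3.35) p.396, (3.3)-(3.4) pp.390-391] -/
theorem norm_covDstar_covD_conjFrame_le_pair {P : S → 𝔸ˣ} (hP : ∀ z : S, ‖(P z : 𝔸)‖ ≤ 1 ∧ ‖(((P z)⁻¹ : 𝔸ˣ) : 𝔸)‖ ≤ 1)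
    (hU : ∀ (κ : ι) (z : S), ‖(U κ z : 𝔸)‖ ≤ 1 ∧ ‖(((U κ z)⁻¹ : 𝔸ˣ) : 𝔸)‖ ≤ 1) (m c : 𝔸) (hc : ∀ a : 𝔸, Commute c a) (μ : ι) (x : S) :
    ‖covDstar T U μ (covD T U μ (fun z => R (P z) m)) x‖
      ≤ 2 * (‖(((P x)⁻¹ * U μ x * P (T μ x) : 𝔸ˣ) : 𝔸) - (((P ((T μ).symm x))⁻¹ * U μ ((T μ).symm x) * P x : 𝔸ˣ) : 𝔸)‖
          + ‖(((P x)⁻¹ * U μ x * P (T μ x) : 𝔸ˣ) : 𝔸) - 1‖ ^ 2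
          + ‖(((P ((T μ).symm x))⁻¹ * U μ ((T μ).symm x) * P x : 𝔸ˣ) : 𝔸) - 1‖ ^ 2) * ‖m - c‖ := by
  rw [covDstar_covD_conjFrame]
  set h₁ : 𝔸ˣ := (P x)⁻¹ * U μ x * P (T μ x) with hh₁
  set h₂ : 𝔸ˣ := (P ((T μ).symm x))⁻¹ * U μ ((T μ).symm x) * P x with hh₂
  have b₁ := bicontr_mul (bicontr_mul (bicontr_inv (hP x)) (hU μ x)) (hP (T μ x))
  have b₂ := bicontr_mul (bicontr_mul (bicontr_inv (hP ((T μ).symm x))) (hU μ ((T μ).symm x))) (hP x)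
  have hrew : (m - R h₂⁻¹ m) - (R h₁ m - m) = -((R h₁ m - m) + (R h₂⁻¹ m - m)) := by abel
  calc ‖R (P x) ((m - R h₂⁻¹ m) - (R h₁ m - m))‖ ≤ ‖(m - R h₂⁻¹ m) - (R h₁ m - m)‖ := norm_R_le (hP x).1 (hP x).2 _
    _ = ‖(R h₁ m - m) + (R h₂⁻¹ m - m)‖ := by rw [hrew, norm_neg]
    _ ≤ 2 * (‖(h₁ : 𝔸) - h₂‖ + ‖(h₁ : 𝔸) - 1‖ ^ 2 + ‖(h₂ : 𝔸) - 1‖ ^ 2) * ‖m - c‖ := norm_symmPair_le b₁ b₂ m c hc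

end PairNorm

end Summit.QuantumFields.YangMills.Theorems.Prop7ConjFrameTransport

end
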